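import Literature.AlgebraicGeometry.Motives.LineSweptSurfaces
import Literature.AlgebraicGeometry.Motives.TangentLineFamilyCycle
import HarnessLib

/-!
# The osculating- and tangent-line relations with LINE-SWEPT residual terms, in every dimension

`Motives/OsculatingLineFamilyRelation`, `Motives/PlanesGenerateChowTwoOfCubic` (the engine
`exists_relation_of_line_over_T`) and `Motives/TangentLinesChowTwo` prove, for a cubic hypersurface
`X ⊆ ℙᵈ⁺¹` with `d ≥ 14`, the relations "`3 [S] ≡ a h + (planes)`", "`[x]-section ≡ [y]-section +
(planes)`", "`2 [S] + [β-section] ≡ a h + (planes)`" over a surface base `T`, where the bound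
`d ≥ 14` enters ONLY through the conversion of the vertical components — surfaces swept out by the
lines of `X` over curves of `T` — into planes. R. Mboro, *Remarks on the `CH₂` of cubic
hypersurfaces* (arXiv:1701.04488), keeps these terms as they are: "the residual cycle `R` is
supported on … `ℙ_{Σ̃₁}` … `R` is a cycle in the image of `P_*`" (proof of Thm. 1.2, p. 7). This file
re-proves the four relations with the vertical terms kept as cycles supported on LINE-SWEPT points
(`ProjFamily.IsLineSweptPoint`, `Motives/LineSweptSurfaces`), hence WITHOUT any dimension bound:

* `ProjFamily.exists_relation_of_line_over_T_lineSwept` — the engine: the two sections of a family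
  of lines on `X` over `T` differ by `Rat₂` and line-swept terms;
* `ProjFamily.exists_relation_of_osculating_line_over_T_lineSwept` (Mboro Thm. 1.2, Case 2),
  `ProjFamily.exists_relation_of_line_in_X_over_T_lineSwept` (Case 1),
  `ProjFamily.exists_relation_of_tangent_line_over_T_lineSwept` (the tangent lines of the proof of
  Thm. 1.3), `ProjFamily.exists_relation_of_line_in_X_over_T'_lineSwept`.

The proofs are those of the plane versions verbatim, with `exists_planes_restrictMapFst_of_vertical`
/ `exists_planes_of_vertical` replaced by `restrictMapFst_vertical_lineSwept` /
`exists_lineSwept_of_vertical'`. Everything is proved; no named facts.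

## References

* [Mboro2018] R. Mboro, Remarks on the CH₂ of cubic hypersurfaces, arXiv:1701.04488, proof of
  Thm. 1.2, Cases 1–2 (p. 7) and of Thm. 1.3 (p. 8).
* [Fulton1998] W. Fulton, Intersection Theory, 2nd ed. (1998), Def. 2.3, Prop. 2.3, Cor. 2.4.1.
* [TianZong2014] Z. Tian, H. R. Zong, One-cycles on rationally connected varieties, Compositio
  Math. 150 (2014), Prop. 7.2 (proof).
-/

noncomputable section

open CategoryTheory CategoryTheory.Limits AlgebraicGeometry MonoidalCategory MvPolynomial
  TopologicalSpace Order Topology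
open Literature.AlgebraicGeometry.Motives.Segre Literature.AlgebraicGeometry.Motives.RatFn
  Literature.RingTheory.OrderOfVanishing

universe u

namespace Literature.AlgebraicGeometry.Motives

attribute [local instance] MvPolynomial.gradedAlgebra MvPolynomial.algebraMvPolynomial
  Literature.AlgebraicGeometry.Motives.ProjBaseChange.algebraBase
  UniversalHyperplaneSection.sectionsAlgebra ProjFamily.functionFieldAlgebra

namespace ProjFamily

open ProjBaseChangeRing ProjectiveSpaceCells ProjectiveSpace FanoScheme ProjSpace
  Literature.RingTheory.MvPolynomial Literature.FieldTheory.QuasiAlgClosed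

variable {k : Type u} [Field k]

/-! ### The engine with line-swept vertical terms -/

section Engine

variable [IsAlgClosed k] {d : ℕ} (T : SchemeOver k) [IsIntegral T.left] [IsProper T.hom]
  (X : SchemeOver k) (i : X ⟶ projectiveSpace (d + 1) k) [IsClosedImmersion i.left]
  {F : MvPolynomial (Fin (d + 1 + 1)) k}

/-- **The relation for one line over the surface base.** For independent `v₀, v₁ ∈ k(T)ᵈ⁺²` with
`F` vanishing on their span (a `k(T)`-line of `X_{k(T)}`) whose Plücker point is the generic point
of a `k`-morphism `f : T → ℙ^𝐍`: there are `c' ∈ Rat₂(X ×ₖ T)`, the lifts `u₀, u₁ ∈ X_{k(T)}` of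
`[v₀], [v₁]`, and a cycle `Pl` on `X` supported on LINE-SWEPT points with
`pr₁₊ c' - (pr₁₊[ι u₀] - pr₁₊[ι u₁]) - Pl ∈ Rat₂(X)` (the vertical components are sums of planes,
`exists_planes_of_vertical`). [cite: TianZong2014, Prop. 7.2 (proof)] -/
theorem exists_relation_of_line_over_T_lineSwept
    (hrange : Set.range i.left.base =
      ProjectiveSpectrum.zeroLocus (homogeneousSubmodule (Fin (d + 1 + 1)) k) {F})
    (hT2 : height (genericPoint T.left) = 2)
    [QuasiCompact (CartesianMonoidalCategory.fst X T).left]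
    (f : T ⟶ projectiveSpace ((d + 1) * (d + 1) + 2 * (d + 1)) k)
    (v : Fin 2 → Fin (d + 1 + 1) → T.left.functionField)
    (hv : LinearIndependent T.left.functionField v)
    (hFv : ∀ s t : T.left.functionField,
      eval (s • v 0 + t • v 1) (MvPolynomial.map (algebraMap k T.left.functionField) F) = 0)
    (P : Fin ((d + 1) * (d + 1) + 2 * (d + 1) + 1) → T.left.functionField)
    (hPw : ∀ a b, P (plIdx (d + 1) (a, b)) = wedge (v 0) (v 1) a b) (hP0 : P ≠ 0)
    (hP : qgen T ≫ f.left = (pointOfVec k P hP0).left) :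
    ∃ c' ∈ ratTrivial (X ⊗ T).left 2, ∃ uX : Fin 2 → ↥(XK T X),
      (∀ a, (iK (d + 1) T X i).base (uX a) =
        (pointOfVec T.left.functionField (v a) (hv.ne_zero a)).pt) ∧
      ∃ Pl : AlgebraicCycle X.left ℤ, (∀ y, Pl y ≠ 0 → IsLineSweptPoint i y) ∧
        AlgebraicCycle.map (CartesianMonoidalCategory.fst X T).left height height c' -
          (AlgebraicCycle.map (CartesianMonoidalCategory.fst X T).left height height
              (primeCycle ((ιX T X).base (uX 0))) -
            AlgebraicCycle.map (CartesianMonoidalCategory.fst X T).left height height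
              (primeCycle ((ιX T X).base (uX 1)))) - Pl ∈ ratTrivial X.left 2 := by
  classical
  haveI : IsProper (projectiveSpace (d + 1) k).hom := isProper_projectiveSpace (d + 1) k
  haveI : IsProper X.hom := by rw [← Over.w i]; infer_instance
  haveI : QuasiCompact (X ⊗ T).hom :=
    inferInstanceAs (QuasiCompact (pullback.fst X.hom T.hom ≫ X.hom))
  haveI : CompactSpace ↥(X ⊗ T).left := compactSpace_of_quasiCompact_hom (X ⊗ T)
  haveI := infinite_functionField (k := k) T
  have hN : 1 ≤ d + 1 := by omega
  obtain ⟨μ, hμli, hμhom, hμv, hμideal⟩ := exists_lineForms v hv hN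
  have hFspan : MvPolynomial.map (algebraMap k T.left.functionField) F ∈ Ideal.span (Set.range μ) :=
    hμideal _ hFv
  have hrange' : Set.range i.left.base =
      ProjectiveSpectrum.zeroLocus (homogeneousSubmodule (Fin (d + 1 + 1)) k)
        (Set.range fun _ : Fin 1 => F) := by
    rw [hrange]; congr 1; ext G; simp
  have hline := zeroLocus_subset_range_iK (d + 1) T X i (fun _ : Fin 1 => F) hrange' μ
    (fun _ => hFspan)
  have hu : ∀ a, (pointOfVec T.left.functionField (v a) (hv.ne_zero a)).pt ∈
      ProjectiveSpectrum.zeroLocus (homogeneousSubmodule (Fin (d + 1 + 1)) T.left.functionField)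
        (Set.range μ) := by
    rintro a _ ⟨l, rfl⟩
    exact mem_asHomogeneousIdeal_pt_pointOfVec (hv.ne_zero a) zero_lt_one (hμhom l) (hμv l a)
  obtain ⟨c', hc', uX, vX, lamX, huX, hvX, hlamX, vert, hcv, hvert⟩ :=
    exists_relation_of_two_points_on_line_surfaceBase T X i hN hT2 μ hμli hμhom hline (hu 0) (hu 1)
      (height_pt _) (height_pt _) (by rw [residueDegree_pt, residueDegree_pt])
  -- push-forward
  let M : AlgebraicCycle (X ⊗ T).left ℤ →+ AlgebraicCycle X.left ℤ :=
    AddMonoidHom.mk' (AlgebraicCycle.map (CartesianMonoidalCategory.fst X T).left height height)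
      (algebraicCycleMap_add _ height height)
  -- every vertical component pushes forward to a multiple of a line-swept point
  have hjι : ∀ q, (i ▷ T).left.base ((ιX T X).base q) =
      (genericFibreι (d + 1) T).base ((iK (d + 1) T X i).base q) := by
    intro q
    change ((ιX T X ≫ (i ▷ T).left).base q) = ((iK (d + 1) T X i ≫ genericFibreι (d + 1) T).base q)
    rw [iK_genericFibreι]
  have hV : ∀ z, vert z ≠ 0 → ∃ Plz : AlgebraicCycle X.left ℤ,
      (∀ y, Plz y ≠ 0 → IsLineSweptPoint i y) ∧
        M (primeCycle z) - Plz ∈ ratTrivial X.left 2 := by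
    intro z hz
    obtain ⟨hz2, hzη, hzS⟩ := hvert z hz
    have hwS : (i ▷ T).left.base z ∈
        closure {(genericFibreι (d + 1) T).base (linearSubspacePoint μ hμli hμhom (Nat.sub_le (d + 1) 1))} := by
      have h := image_closure_subset_closure_image (i ▷ T).left.base.hom.continuous
        (s := {(ιX T X).base lamX}) ⟨z, hzS, rfl⟩
      rw [Set.image_singleton, hjι, hlamX] at h
      exact h
    obtain ⟨m, y', hmy, hls⟩ := exists_lineSwept_of_vertical' T X i hT2 f (v 0) (v 1) P hPw hP0 hP hμli
      hμhom hμideal hz2 hzη hwS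
    refine ⟨M (primeCycle z), fun y hy => ?_, by rw [sub_self]; exact AddSubgroup.zero_mem _⟩
    change AlgebraicCycle.map (CartesianMonoidalCategory.fst X T).left height height (primeCycle z) y ≠ 0 at hy
    rw [hmy] at hy
    have hm : m ≠ 0 := by
      rintro rfl
      exact hy (by rw [zero_nsmul]; rfl)
    have hyy : y = y' := by
      by_contra hne
      exact hy (by rw [Function.locallyFinsuppWithin.coe_nsmul, Pi.smul_apply, primeCycle_apply_of_ne hne, nsmul_zero])
    rw [hyy]
    exact hls hm
  choose! Plz hPlz using hV
  let S : Finset ↥(X ⊗ T).left := (finite_support_of_compactSpace vert).toFinset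
  have hSmem : ∀ z, z ∈ S ↔ vert z ≠ 0 := fun z => by
    simp only [S, Set.Finite.mem_toFinset, Function.mem_support]
  let Pl : AlgebraicCycle X.left ℤ := ∑ z ∈ S, vert z • Plz z
  have hPl : ∀ y, Pl y ≠ 0 → IsLineSweptPoint i y := by
    intro y hy
    have : ∃ z ∈ S, (Plz z) y ≠ 0 := by
      by_contra hnone
      push Not at hnone
      apply hy
      simp only [Pl, Function.locallyFinsuppWithin.coe_sum, Finset.sum_apply,
        Function.locallyFinsuppWithin.coe_zsmul, Pi.smul_apply, smul_eq_mul]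
      exact Finset.sum_eq_zero fun z hz => by rw [hnone z hz, mul_zero]
    obtain ⟨z, hzS, hzy⟩ := this
    exact (hPlz z ((hSmem z).1 hzS)).1 y hzy
  have hvertsum : vert = ∑ z ∈ S, vert z • primeCycle z :=
    eq_sum_smul_primeCycle_of_support_subset vert (s := S) (by
      intro z hz; exact (Finset.mem_coe.2 ((hSmem z).2 (Function.mem_support.1 hz))))
  have hMvert : M vert - Pl ∈ ratTrivial X.left 2 := by
    have hdiff : M vert - Pl = ∑ z ∈ S, vert z • (M (primeCycle z) - Plz z) := by
      conv_lhs => rw [hvertsum]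
      simp only [Pl, map_sum, map_zsmul, ← Finset.sum_sub_distrib, smul_sub]
    rw [hdiff]
    exact AddSubgroup.sum_mem _ fun z hz => AddSubgroup.zsmul_mem _ (hPlz z ((hSmem z).1 hz)).2 _
  refine ⟨c', hc', ![uX, vX], fun a => ?_, Pl, hPl, ?_⟩
  · fin_cases a
    · exact huX
    · exact hvX
  · have hMc : M c' = M (primeCycle ((ιX T X).base uX)) - M (primeCycle ((ιX T X).base vX)) + M vert := by
      rw [hcv, map_add, map_sub]
    change M c' - (M (primeCycle ((ιX T X).base uX)) - M (primeCycle ((ιX T X).base vX))) - Pl ∈ _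
    rw [hMc]
    convert hMvert using 1
    abel


end Engine

/-! ### The four relations over a surface base -/

section Relation

variable [IsAlgClosed k] {d : ℕ} (T : SchemeOver k) [IsIntegral T.left] [IsProper T.hom]
  (X : SchemeOver k) [IsIntegral X.left] [LocallyOfFiniteType X.hom]
  (i : X ⟶ projectiveSpace (d + 1) k) [IsClosedImmersion i.left]
  {F : MvPolynomial (Fin (d + 1 + 1)) k}

/-- **Mboro's osculating-line relation over a surface base, on the cubic hypersurface** (proof of
Thm. 1.2, Case 2, with "`3 H_X · f_*(1) = i_X^* i_{X,*} f_*(1) ∈ ℤ · H_X^{d-2}`"). Let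
`X = V₊(F) ⊆ ℙᵈ⁺¹_k` be an integral cubic hypersurface over an algebraically closed field, `d ≥ 14`,
`M = V₊(ℓ₁, …, ℓ_c) ⊄ X` a `3`-plane (`2 + c = d`) whose hyperplanes do not contain `X`, `T` an
integral proper surface base (`dim = 2`) with a morphism `f : T → ℙ^𝐍` whose generic point is the
Plücker point of the `k(T)`-line `[x][y]`, which osculates `V₊(F)` at `[x]`
(`F(s x + t y) = t³ F(y)`) and is not on it (`F(y) ≠ 0`). Then there are `a ∈ ℤ` and a cycle `Pl`
on `X` supported on plane points with
`3 · (pr₁₊[closure ι([x])])|_X - a · (V₊(ℓ_c)|_X ⋯ V₊(ℓ₁)|_X · [X]) - Pl ∈ Rat₂(X)`.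
[cite: Mboro2018, proof of Thm. 1.2, Case 2 (arXiv:1701.04488, p. 7)] [cite: Fulton1998, Prop. 2.3 (c), Cor. 2.4.1, Example 1.9.3] [cite: TianZong2014, Prop. 7.2 (proof)] -/
theorem exists_relation_of_osculating_line_over_T_lineSwept (hF : F ∈ grading (Fin (d + 1 + 1)) k 3) (hprime : Prime F)
    (hrange : Set.range i.left.base =
      ProjectiveSpectrum.zeroLocus (homogeneousSubmodule (Fin (d + 1 + 1)) k) {F})
    (hT2 : height (genericPoint T.left) = 2)
    {c : ℕ} (hdim : 2 + c = d) (ℓ : Fin c → MvPolynomial (Fin (d + 1 + 1)) k)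
    (hℓ : ∀ j, ℓ j ∈ grading (Fin (d + 1 + 1)) k 1) (hlin : LinearIndependent k ℓ)
    (hav : ∀ j, (formDivisor (ℓ j) (hℓ j) (hlin.ne_zero j)).Avoids (i.left.base (genericPoint ↥X.left)))
    (w : ↥(projectiveSpace (d + 1) k).left)
    (hw : (ProjectiveSpectrum.asHomogeneousIdeal
      (𝒜 := homogeneousSubmodule (Fin (d + 1 + 1)) k) w).toIdeal = Ideal.span (Set.range ℓ))
    (hFw : F ∉ ProjectiveSpectrum.asHomogeneousIdeal (𝒜 := homogeneousSubmodule (Fin (d + 1 + 1)) k) w)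
    (f : T ⟶ projectiveSpace ((d + 1) * (d + 1) + 2 * (d + 1)) k)
    (x y : Fin (d + 1 + 1) → T.left.functionField)
    (hxy : LinearIndependent T.left.functionField ![x, y])
    (hosc : ∀ s t : T.left.functionField,
      eval (s • x + t • y) (MvPolynomial.map (algebraMap k T.left.functionField) F) =
        t ^ 3 * eval y (MvPolynomial.map (algebraMap k T.left.functionField) F))
    (hFy : eval y (MvPolynomial.map (algebraMap k T.left.functionField) F) ≠ 0)
    (P : Fin ((d + 1) * (d + 1) + 2 * (d + 1) + 1) → T.left.functionField)
    (hPw : ∀ a b, P (plIdx (d + 1) (a, b)) = wedge x y a b) (hP0 : P ≠ 0)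
    (hP : qgen T ≫ f.left = (pointOfVec k P hP0).left) :
    ∃ (a : ℤ) (Pl : AlgebraicCycle X.left ℤ), (∀ y', Pl y' ≠ 0 → IsLineSweptPoint i y') ∧
      3 • restrictMapFst T X i (primeCycle (genericFibreι (d + 1) T
          (pointOfVec T.left.functionField x (by simpa using hxy.ne_zero 0)).pt)) -
        a • CartierDivisor.iterInter c
          (fun j => (formDivisor (ℓ j) (hℓ j) (hlin.ne_zero j)).pullbackAvoiding i.left (hav j))
          (primeCycle (genericPoint ↥X.left)) - Pl ∈ ratTrivial X.left 2 := by
  classical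
  haveI := infinite_functionField (k := k) T
  have hN : 1 ≤ d + 1 := by omega
  have hF0 : F ≠ 0 := hprime.ne_zero
  have hF3 : F.IsHomogeneous 3 := (mem_homogeneousSubmodule 3 F).1 hF
  -- the line forms
  obtain ⟨μ, hμli, hμhom, hμv, hμideal⟩ := exists_lineForms ![x, y] hxy hN
  have hμx : ∀ l, eval x (μ l) = 0 := fun l => hμv l 0
  have hμy : ∀ l, eval y (μ l) = 0 := fun l => hμv l 1
  have hμideal' : ∀ G : MvPolynomial (Fin (d + 1 + 1)) T.left.functionField,
      (∀ s t : T.left.functionField, eval (s • x + t • y) G = 0) → G ∈ Ideal.span (Set.range μ) :=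
    fun G hG => hμideal G fun s t => hG s t
  let R := restrictMapFst T X i
  -- (1) `pr₁^*V₊(F) · [closure ι(l)] = 3 [closure ι([x])] + V`
  obtain ⟨V, hZ, -, hVsupp⟩ := exists_primeInter_pullbackFormDivisor_line_eq (B := T) hN hT2 hxy
    hF hF0 hosc hFy hμli hμhom hμx hμy hμideal'
  -- (2) the vertical part pushes forward to planes
  obtain ⟨Pl, hPl, hRV⟩ : ∃ Pl : AlgebraicCycle X.left ℤ, (∀ y', Pl y' ≠ 0 → IsLineSweptPoint i y') ∧
      restrictMapFst T X i V - Pl ∈ ratTrivial X.left 2 :=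
    ⟨restrictMapFst T X i V, restrictMapFst_vertical_lineSwept T X i hrange hT2 f x y P hPw hP0 hP hμli hμhom
      hμideal' V hVsupp, by rw [sub_self]; exact AddSubgroup.zero_mem _⟩
  -- (3) `(pr₁₊(pr₁^*V₊(F) · [closure ι(l)]))|_X ≡ a · [X ∩ M]`
  have hlam1 : height (linearSubspacePoint μ hμli hμhom (Nat.sub_le (d + 1) 1)) = 1 :=
    height_linearSubspacePoint_of_line hN μ hμli hμhom
  have hιlam : height (genericFibreι (d + 1) T (linearSubspacePoint μ hμli hμhom (Nat.sub_le (d + 1) 1))) =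
      (2 : ℕ) + 1 := by
    rw [height_genericFibreι_apply (d + 1) T hT2, hlam1]
  obtain ⟨a, ha⟩ := exists_restrictMapFst_primeInter_sub_mem T X i hF hprime hrange hdim ℓ hℓ hlin hav
    w hw hFw hιlam
  -- (4) assemble (with the plane cycle `-Pl`)
  refine ⟨a, -Pl, fun y' hy' => hPl y' (by
    rwa [Function.locallyFinsuppWithin.coe_neg, Pi.neg_apply, neg_ne_zero] at hy'), ?_⟩
  have hRZ : R ((pullbackFormDivisor (B := T) hF hF0).primeInter (X := (projectiveSpace (d + 1) k) ⊗ T)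
      (genericFibreι (d + 1) T (linearSubspacePoint μ hμli hμhom (Nat.sub_le (d + 1) 1)))) =
      3 • R (primeCycle (genericFibreι (d + 1) T
        (pointOfVec T.left.functionField x (by simpa using hxy.ne_zero 0)).pt)) + R V := by
    rw [hZ, map_add, map_nsmul]
  have key : 3 • R (primeCycle (genericFibreι (d + 1) T
        (pointOfVec T.left.functionField x (by simpa using hxy.ne_zero 0)).pt)) -
      a • CartierDivisor.iterInter c
        (fun j => (formDivisor (ℓ j) (hℓ j) (hlin.ne_zero j)).pullbackAvoiding i.left (hav j))
        (primeCycle (genericPoint ↥X.left)) - -Pl =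
      (R ((pullbackFormDivisor (B := T) hF hF0).primeInter (X := (projectiveSpace (d + 1) k) ⊗ T)
          (genericFibreι (d + 1) T (linearSubspacePoint μ hμli hμhom (Nat.sub_le (d + 1) 1)))) -
        a • CartierDivisor.iterInter c
          (fun j => (formDivisor (ℓ j) (hℓ j) (hlin.ne_zero j)).pullbackAvoiding i.left (hav j))
          (primeCycle (genericPoint ↥X.left))) - (R V - Pl) := by
    rw [hRZ]; abel
  rw [key]
  exact AddSubgroup.sub_mem _ ha hRV

/-! ### Case 1: the line lies on `X` -/

/-- **Mboro's relation over a surface base when the lines lie on `X`** (proof of Thm. 1.2, Case 1: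
"`Σ = H_X · f_*(1) + P_*(p_* σ̃_*(D))`" and "`d H_X · f_*(1) = i_X^* i_{X,*} f_*(1) ∈ ℤ · H_X^{n-r}`").
Same setting as `exists_relation_of_osculating_line_over_T`, but with the `k(T)`-line `[x][y]`
contained in `X_{k(T)}` (`F ≡ 0` on `span(x, y)`). Then again there are `a ∈ ℤ` and a cycle `Pl`
on `X` supported on plane points with
`3 · (pr₁₊[closure ι([x])])|_X - a · (V₊(ℓ_c)|_X ⋯ V₊(ℓ₁)|_X · [X]) - Pl ∈ Rat₂(X)`.
Proof: for a coordinate hyperplane `V₊(ν) ∌ [x]` and the point `p = l ∩ V₊(ν)`, the two sections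
`[x]`, `p` of the family differ by planes (`exists_relation_of_line_over_T`, the relation
`[u] - [v]` on the line spread over `T`); `pr₁^*V₊(ν) · [W♯] = [closure ι(p)] + (vertical)`
(`exists_primeInter_pullbackFormDivisor_line_eq_of_linear`) — this is `H_X · f_*(1)`;
`pr₁^*V₊(F) ∼ 3 pr₁^*V₊(ν)` so `pr₁^*V₊(F) · [W♯] ≡ 3 pr₁^*V₊(ν) · [W♯]` in `Rat₂(W♯)`
(Fulton Def. 2.3 / Prop. 2.3 (b)), pushed into `X ⊇ pr₁(W♯)`; and
`(pr₁₊(pr₁^*V₊(F) · [W♯]))|_X ≡ a · [X ∩ M]` (`exists_restrictMapFst_primeInter_sub_mem`).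
[cite: Mboro2018, proof of Thm. 1.2, Case 1 (arXiv:1701.04488, p. 7)] [cite: Fulton1998, Def. 2.3, Prop. 2.3 (b), (c), Cor. 2.4.1] [cite: TianZong2014, Prop. 7.2 (proof)] -/
theorem exists_relation_of_line_in_X_over_T_lineSwept (hF : F ∈ grading (Fin (d + 1 + 1)) k 3) (hprime : Prime F)
    (hrange : Set.range i.left.base =
      ProjectiveSpectrum.zeroLocus (homogeneousSubmodule (Fin (d + 1 + 1)) k) {F})
    (hT2 : height (genericPoint T.left) = 2)
    {c : ℕ} (hdim : 2 + c = d) (ℓ : Fin c → MvPolynomial (Fin (d + 1 + 1)) k)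
    (hℓ : ∀ j, ℓ j ∈ grading (Fin (d + 1 + 1)) k 1) (hlin : LinearIndependent k ℓ)
    (hav : ∀ j, (formDivisor (ℓ j) (hℓ j) (hlin.ne_zero j)).Avoids (i.left.base (genericPoint ↥X.left)))
    (w : ↥(projectiveSpace (d + 1) k).left)
    (hw : (ProjectiveSpectrum.asHomogeneousIdeal
      (𝒜 := homogeneousSubmodule (Fin (d + 1 + 1)) k) w).toIdeal = Ideal.span (Set.range ℓ))
    (hFw : F ∉ ProjectiveSpectrum.asHomogeneousIdeal (𝒜 := homogeneousSubmodule (Fin (d + 1 + 1)) k) w)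
    (f : T ⟶ projectiveSpace ((d + 1) * (d + 1) + 2 * (d + 1)) k)
    (x y : Fin (d + 1 + 1) → T.left.functionField)
    (hxy : LinearIndependent T.left.functionField ![x, y])
    (hFline : ∀ s t : T.left.functionField,
      eval (s • x + t • y) (MvPolynomial.map (algebraMap k T.left.functionField) F) = 0)
    (P : Fin ((d + 1) * (d + 1) + 2 * (d + 1) + 1) → T.left.functionField)
    (hPw : ∀ a b, P (plIdx (d + 1) (a, b)) = wedge x y a b) (hP0 : P ≠ 0)
    (hP : qgen T ≫ f.left = (pointOfVec k P hP0).left) :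
    ∃ (a : ℤ) (Pl : AlgebraicCycle X.left ℤ), (∀ y', Pl y' ≠ 0 → IsLineSweptPoint i y') ∧
      3 • restrictMapFst T X i (primeCycle (genericFibreι (d + 1) T
          (pointOfVec T.left.functionField x (by simpa using hxy.ne_zero 0)).pt)) -
        a • CartierDivisor.iterInter c
          (fun j => (formDivisor (ℓ j) (hℓ j) (hlin.ne_zero j)).pullbackAvoiding i.left (hav j))
          (primeCycle (genericPoint ↥X.left)) - Pl ∈ ratTrivial X.left 2 := by
  classical
  haveI := infinite_functionField (k := k) T
  haveI : IsProper (projectiveSpace (d + 1) k).hom := isProper_projectiveSpace (d + 1) k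
  haveI : IsProper X.hom := by rw [← Over.w i]; infer_instance
  haveI : LocallyOfFiniteType (X ⊗ T).hom :=
    inferInstanceAs (LocallyOfFiniteType (pullback.fst X.hom T.hom ≫ X.hom))
  have hN : 1 ≤ d + 1 := by omega
  have hF0 : F ≠ 0 := hprime.ne_zero
  have hF3 : F.IsHomogeneous 3 := (mem_homogeneousSubmodule 3 F).1 hF
  have hx0 : x ≠ 0 := by simpa using hxy.ne_zero 0
  have hpair := LinearIndependent.pair_iff.1 hxy
  -- notation
  let K := T.left.functionField
  let ι := genericFibreι (d + 1) T
  let fstP := (CartesianMonoidalCategory.fst (projectiveSpace (d + 1) k) T).left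
  let R := restrictMapFst T X i
  let M : AlgebraicCycle (X ⊗ T).left ℤ → AlgebraicCycle X.left ℤ :=
    AlgebraicCycle.map (CartesianMonoidalCategory.fst X T).left height height
  -- a coordinate hyperplane `V₊(ν)`, `ν = X_{j₀}`, with `ν(x) ≠ 0`, and the point `p = l ∩ V₊(ν)`
  obtain ⟨j₀, hj₀⟩ := Function.ne_iff.mp hx0
  let ν : MvPolynomial (Fin (d + 1 + 1)) k := MvPolynomial.X j₀
  have hν : ν ∈ grading (Fin (d + 1 + 1)) k 1 := X_mem k j₀
  have hν0 : ν ≠ 0 := MvPolynomial.X_ne_zero j₀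
  have hνK : MvPolynomial.map (algebraMap k T.left.functionField) ν = MvPolynomial.X j₀ := map_X _ _
  have hνhom : (MvPolynomial.map (algebraMap k T.left.functionField) ν).IsHomogeneous 1 := by
    rw [hνK]; exact isHomogeneous_X _ _
  have hνx : eval x (MvPolynomial.map (algebraMap k T.left.functionField) ν) ≠ 0 := by
    rw [hνK, eval_X]; exact hj₀
  let p : Fin (d + 1 + 1) → T.left.functionField :=
    eval y (MvPolynomial.map (algebraMap k T.left.functionField) ν) • x +
      (-eval x (MvPolynomial.map (algebraMap k T.left.functionField) ν)) • y
  have hνp : eval p (MvPolynomial.map (algebraMap k T.left.functionField) ν) = 0 := by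
    change eval (_ • x + _ • y) _ = 0
    rw [eval_add_smul_of_isHomogeneous_one hνhom]
    ring
  have hp0 : p ≠ 0 := by
    intro h
    have h2 := (hpair _ _ h).2
    exact hνx (neg_eq_zero.1 h2)
  -- the pair `x, p`
  have hlin_xp : ∀ s t : T.left.functionField, s • x + t • p =
      (s + t * eval y (MvPolynomial.map (algebraMap k T.left.functionField) ν)) • x +
        (-(t * eval x (MvPolynomial.map (algebraMap k T.left.functionField) ν))) • y := by
    intro s t
    ext j
    simp only [p, Pi.add_apply, Pi.smul_apply, smul_eq_mul]
    ring
  have hv : LinearIndependent T.left.functionField ![x, p] := by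
    refine LinearIndependent.pair_iff.2 fun s t hst => ?_
    rw [hlin_xp] at hst
    obtain ⟨h1, h2⟩ := hpair _ _ hst
    have ht : t = 0 := by
      rcases mul_eq_zero.1 (neg_eq_zero.1 h2) with h | h
      · exact h
      · exact absurd h hνx
    refine ⟨?_, ht⟩
    rw [ht, zero_mul, add_zero] at h1
    exact h1
  have hFv : ∀ s t : T.left.functionField,
      eval (s • x + t • p) (MvPolynomial.map (algebraMap k T.left.functionField) F) = 0 := by
    intro s t
    rw [hlin_xp]
    exact hFline _ _
  -- Plücker data of the pair `x, p`
  let P' : Fin ((d + 1) * (d + 1) + 2 * (d + 1) + 1) → T.left.functionField :=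
    (-eval x (MvPolynomial.map (algebraMap k T.left.functionField) ν)) • P
  have hP'w : ∀ a b, P' (plIdx (d + 1) (a, b)) = wedge x p a b := by
    intro a b
    change (-eval x _) * P (plIdx (d + 1) (a, b)) = wedge x (_ • x + _ • y) a b
    rw [wedge_self_add_smul, hPw]
    rfl
  have hc0 : -eval x (MvPolynomial.map (algebraMap k T.left.functionField) ν) ≠ 0 := neg_ne_zero.2 hνx
  have hP'0 : P' ≠ 0 := smul_ne_zero hc0 hP0
  have hP' : qgen T ≫ f.left = (pointOfVec k P' hP'0).left := by
    rw [hP]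
    exact congrArg CommaMorphism.left (pointOfVec_smul (k := k) P hP0 _ hc0 hP'0).symm
  -- (1) the two sections `[x]`, `p` differ by planes
  obtain ⟨c', hc', uX, huX, Pl₁, hPl₁, hE⟩ := exists_relation_of_line_over_T_lineSwept T X i hrange hT2 f
    ![x, p] hv hFv P' hP'w hP'0 hP'
  have hMc' : M c' ∈ ratTrivial X.left 2 :=
    map_mem_ratTrivial_holds (d := 2) (CartesianMonoidalCategory.fst X T) hc'
  have hjι : ∀ q, (i ▷ T).left.base ((ιX T X).base q) = ι ((iK (d + 1) T X i).base q) := by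
    intro q
    change ((ιX T X ≫ (i ▷ T).left).base q) = ((iK (d + 1) T X i ≫ genericFibreι (d + 1) T).base q)
    rw [iK_genericFibreι]
  have hMu : ∀ a, M (primeCycle ((ιX T X).base (uX a))) =
      R (primeCycle (ι (pointOfVec T.left.functionField (![x, p] a) (hv.ne_zero a)).pt)) := by
    intro a
    rw [← huX a, ← hjι]
    exact (restrictMapFst_primeCycle_whiskerRight T X i _).symm
  have hE1 : R (primeCycle (ι (pointOfVec T.left.functionField x hx0).pt)) -
      R (primeCycle (ι (pointOfVec T.left.functionField p hp0).pt)) + Pl₁ ∈ ratTrivial X.left 2 := by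
    have h0 : M (primeCycle ((ιX T X).base (uX 0))) = R (primeCycle (ι (pointOfVec T.left.functionField x hx0).pt)) :=
      hMu 0
    have h1 : M (primeCycle ((ιX T X).base (uX 1))) = R (primeCycle (ι (pointOfVec T.left.functionField p hp0).pt)) :=
      hMu 1
    have key : R (primeCycle (ι (pointOfVec T.left.functionField x hx0).pt)) -
        R (primeCycle (ι (pointOfVec T.left.functionField p hp0).pt)) + Pl₁ =
        M c' - (M c' - (M (primeCycle ((ιX T X).base (uX 0))) - M (primeCycle ((ιX T X).base (uX 1)))) - Pl₁) := by
      rw [h0, h1]; abel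
    rw [key]
    exact AddSubgroup.sub_mem _ hMc' hE
  -- the line forms of `l = span(x, y)`
  obtain ⟨μ, hμli, hμhom, hμv, hμideal⟩ := exists_lineForms ![x, y] hxy hN
  have hμx : ∀ l, eval x (μ l) = 0 := fun l => hμv l 0
  have hμy : ∀ l, eval y (μ l) = 0 := fun l => hμv l 1
  have hμideal' : ∀ G : MvPolynomial (Fin (d + 1 + 1)) T.left.functionField,
      (∀ s t : T.left.functionField, eval (s • x + t • y) G = 0) → G ∈ Ideal.span (Set.range μ) :=
    fun G hG => hμideal G fun s t => hG s t
  have hμp : ∀ l, eval p (μ l) = 0 := by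
    intro l
    change eval (_ • x + _ • y) _ = 0
    rw [eval_add_smul_of_isHomogeneous_one (hμhom l), hμx, hμy, mul_zero, mul_zero, add_zero]
  let lam : ↥(projectiveSpace (d + 1) T.left.functionField).left :=
    linearSubspacePoint μ hμli hμhom (Nat.sub_le (d + 1) 1)
  have hlam1 : height lam = 1 := height_linearSubspacePoint_of_line hN μ hμli hμhom
  have hιlam : height (ι lam) = (2 : ℕ) + 1 := by
    change height (genericFibreι (d + 1) T lam) = _
    rw [height_genericFibreι_apply (d + 1) T hT2, hlam1]
  -- `F ⊗ 1 ∈ 𝔭_l`: the line lies on `X`, so `closure ι(l) ⊆ pr₁⁻¹(X)`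
  have hFlam : MvPolynomial.map (algebraMap k T.left.functionField) F ∈
      ProjectiveSpectrum.asHomogeneousIdeal
        (𝒜 := homogeneousSubmodule (Fin (d + 1 + 1)) T.left.functionField) lam := by
    change _ ∈ (ProjectiveSpectrum.asHomogeneousIdeal
      (𝒜 := homogeneousSubmodule (Fin (d + 1 + 1)) T.left.functionField) lam).toIdeal
    rw [toIdeal_linearSubspacePoint]
    exact hμideal' _ hFline
  have hw₀X : fstP.base (ι lam) ∈ Set.range i.left.base := by
    rw [hrange]
    intro G hG
    rw [Set.mem_singleton_iff.mp hG]
    change F ∈ ProjectiveSpectrum.asHomogeneousIdeal (𝒜 := homogeneousSubmodule (Fin (d + 1 + 1)) k)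
      ((CartesianMonoidalCategory.fst (projectiveSpace (d + 1) k) T).left (genericFibreι (d + 1) T lam))
    rw [fst_genericFibreι_apply, mem_asHomogeneousIdeal_projMap_iff]
    exact hFlam
  have hclX : closure {ι lam} ⊆ fstP.base ⁻¹' Set.range i.left.base :=
    closure_minimal (Set.singleton_subset_iff.2 hw₀X)
      ((i.left.isClosedEmbedding.isClosed_range).preimage fstP.continuous)
  have hZT : fstP.base '' closure {ι lam} ⊆ Set.range i.left.base := by
    rintro _ ⟨w', hw', rfl⟩
    exact hclX hw'
  -- (2) `pr₁^*V₊(ν) · [closure ι(l)] = [closure ι(p)] + V'`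
  obtain ⟨V', hZ', -, hV'supp⟩ := exists_primeInter_pullbackFormDivisor_line_eq_of_linear (B := T) hN
    hT2 (x := p) (y := x) hp0 hν hν0 hνp hνx hμli hμhom hμp hμx
  -- (3) the vertical part of it pushes forward to planes
  have hV'supp' : ∀ w', V' w' ≠ 0 →
      genericFibreι (d + 1) T (linearSubspacePoint μ hμli hμhom (Nat.sub_le (d + 1) 1)) ⤳ w' ∧
      height w' = (2 : ℕ) ∧
      (CartesianMonoidalCategory.snd (projectiveSpace (d + 1) k) T).left w' ≠ genericPoint T.left ∧
      F ∈ ProjectiveSpectrum.asHomogeneousIdeal (𝒜 := homogeneousSubmodule (Fin (d + 1 + 1)) k)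
        ((CartesianMonoidalCategory.fst (projectiveSpace (d + 1) k) T).left w') := fun w' hw' => by
    obtain ⟨hsp, hh2, hη, -⟩ := hV'supp w' hw'
    refine ⟨hsp, hh2, hη, ?_⟩
    have hmem : fstP.base w' ∈ Set.range i.left.base := hclX (specializes_iff_mem_closure.mp hsp)
    rw [hrange] at hmem
    exact hmem (Set.mem_singleton F)
  obtain ⟨Pl₂, hPl₂, hRV'⟩ : ∃ Pl₂ : AlgebraicCycle X.left ℤ, (∀ y', Pl₂ y' ≠ 0 → IsLineSweptPoint i y') ∧
      restrictMapFst T X i V' - Pl₂ ∈ ratTrivial X.left 2 :=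
    ⟨restrictMapFst T X i V', restrictMapFst_vertical_lineSwept T X i hrange hT2 f x y P hPw hP0 hP hμli hμhom
      hμideal' V' hV'supp', by rw [sub_self]; exact AddSubgroup.zero_mem _⟩
  -- (4) `(pr₁₊(pr₁^*V₊(F) · [closure ι(l)]))|_X ≡ a · [X ∩ M]`
  obtain ⟨a, ha⟩ := exists_restrictMapFst_primeInter_sub_mem T X i hF hprime hrange hdim ℓ hℓ hlin hav
    w hw hFw hιlam
  -- (5) `pr₁^*V₊(F) · [W♯] ≡ 3 pr₁^*V₊(ν) · [W♯]` modulo `Rat₂(ℙᵈ⁺¹ ×ₖ T; W♯)`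
  have hνav := formDivisor_avoids_fst_genericPoint (B := T) hν hν0
  have hFav := formDivisor_avoids_fst_genericPoint (B := T) hF hF0
  -- on `ℙᵈ⁺¹_k`: `V₊(F) ∼ V₊(ν) + V₊(ν) + V₊(ν)`
  have h1 : ((1 : ℕ) • hyperplane (d + 1) k).LinEquiv (formDivisor ν hν hν0) := by
    rw [CartierDivisor.one_smul]; exact hyperplane_linEquiv_formDivisor hν hν0
  have hlinP : (formDivisor F hF hF0).LinEquiv
      (formDivisor ν hν hν0 + formDivisor ν hν hν0 + formDivisor ν hν hν0) := by
    have h3 : (formDivisor F hF hF0).LinEquiv (3 • hyperplane (d + 1) k) :=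
      (smul_hyperplane_linEquiv_formDivisor hF hF0).symm
    have h21 : (3 • hyperplane (d + 1) k).LinEquiv
        (2 • hyperplane (d + 1) k + (1 : ℕ) • hyperplane (d + 1) k) :=
      (CartierDivisor.add_smul_sameDivisor (hyperplane (d + 1) k) 2 1).linEquiv
    have h11 : (2 • hyperplane (d + 1) k + (1 : ℕ) • hyperplane (d + 1) k).LinEquiv
        ((1 : ℕ) • hyperplane (d + 1) k + (1 : ℕ) • hyperplane (d + 1) k + (1 : ℕ) • hyperplane (d + 1) k) :=
      (CartierDivisor.add_smul_sameDivisor (hyperplane (d + 1) k) 1 1).linEquiv.add (CartierDivisor.LinEquiv.refl _)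
    exact ((h3.trans h21).trans h11).trans ((h1.add h1).add h1)
  -- pulled back along `pr₁`
  have hlinT : (pullbackFormDivisor (B := T) hF hF0).LinEquiv
      (pullbackFormDivisor (B := T) hν hν0 + pullbackFormDivisor (B := T) hν hν0 +
        pullbackFormDivisor (B := T) hν hν0) := by
    have h := hlinP.pullbackAvoiding fstP hFav ((hνav.add hνav).add hνav)
    refine h.trans ?_
    refine (CartierDivisor.pullbackAvoiding_add_sameDivisor fstP (hνav.add hνav) hνav).linEquiv.trans ?_
    exact (CartierDivisor.pullbackAvoiding_add_sameDivisor fstP hνav hνav).linEquiv.add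
      (CartierDivisor.LinEquiv.refl _)
  have hνlam : MvPolynomial.map (algebraMap k T.left.functionField) ν ∉
      ProjectiveSpectrum.asHomogeneousIdeal
        (𝒜 := homogeneousSubmodule (Fin (d + 1 + 1)) T.left.functionField) lam :=
    notMem_asHomogeneousIdeal_linearSubspacePoint_of_eval_ne_zero hμli hμhom hμx hνx
  have havν : (pullbackFormDivisor (B := T) hν hν0).Avoids (ι lam) :=
    (pullbackFormDivisor_avoids_genericFibreι_iff hν hν0 one_pos lam).2 hνlam
  have hL : (pullbackFormDivisor (B := T) hF hF0).primeInter (X := (projectiveSpace (d + 1) k) ⊗ T) (ι lam) -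
      ((pullbackFormDivisor (B := T) hν hν0).primeInter (X := (projectiveSpace (d + 1) k) ⊗ T) (ι lam) +
        (pullbackFormDivisor (B := T) hν hν0).primeInter (X := (projectiveSpace (d + 1) k) ⊗ T) (ι lam) +
        (pullbackFormDivisor (B := T) hν hν0).primeInter (X := (projectiveSpace (d + 1) k) ⊗ T) (ι lam)) ∈
      ratTrivialOn ((projectiveSpace (d + 1) k) ⊗ T).left (closure {ι lam}) 2 := by
    have h := hlinT.primeInter_sub_primeInter_mem (X := (projectiveSpace (d + 1) k) ⊗ T) hιlam
    rwa [CartierDivisor.primeInter_add (havν.add havν) havν, CartierDivisor.primeInter_add havν havν] at h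
  have hLX : R ((pullbackFormDivisor (B := T) hF hF0).primeInter (X := (projectiveSpace (d + 1) k) ⊗ T) (ι lam)) -
      (R ((pullbackFormDivisor (B := T) hν hν0).primeInter (X := (projectiveSpace (d + 1) k) ⊗ T) (ι lam)) +
        R ((pullbackFormDivisor (B := T) hν hν0).primeInter (X := (projectiveSpace (d + 1) k) ⊗ T) (ι lam)) +
        R ((pullbackFormDivisor (B := T) hν hν0).primeInter (X := (projectiveSpace (d + 1) k) ⊗ T) (ι lam))) ∈
      ratTrivial X.left 2 := by
    have h := cycleRestrictClosed_mem_ratTrivial_of_mem_ratTrivialOn i.left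
      (map_mem_ratTrivialOn_of_image_subset (CartesianMonoidalCategory.fst (projectiveSpace (d + 1) k) T)
        hZT hL)
    rw [← map_add, ← map_add, ← map_sub]
    exact h
  -- (6) assemble, with the plane cycle `-(3 Pl₁ + 3 Pl₂)`
  refine ⟨a, -(3 • Pl₁ + 3 • Pl₂), fun y' hy' => ?_, ?_⟩
  · rw [Function.locallyFinsuppWithin.coe_neg, Pi.neg_apply, neg_ne_zero,
      Function.locallyFinsuppWithin.coe_add, Pi.add_apply] at hy'
    by_cases h1y : Pl₁ y' = 0
    · refine hPl₂ y' fun h2y => hy' ?_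
      rw [Function.locallyFinsuppWithin.coe_nsmul, Function.locallyFinsuppWithin.coe_nsmul, Pi.smul_apply,
        Pi.smul_apply, h1y, h2y, nsmul_zero, add_zero]
    · exact hPl₁ y' h1y
  · have hRH : R ((pullbackFormDivisor (B := T) hν hν0).primeInter (X := (projectiveSpace (d + 1) k) ⊗ T)
        (ι lam)) = R (primeCycle (ι (pointOfVec T.left.functionField p hp0).pt)) + R V' := by
      change R ((pullbackFormDivisor (B := T) hν hν0).primeInter (X := (projectiveSpace (d + 1) k) ⊗ T)
        (genericFibreι (d + 1) T lam)) = _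
      rw [hZ', map_add]
    rw [hRH] at hLX
    have key : 3 • R (primeCycle (ι (pointOfVec T.left.functionField x (by simpa using hxy.ne_zero 0)).pt)) -
        a • CartierDivisor.iterInter c
          (fun j => (formDivisor (ℓ j) (hℓ j) (hlin.ne_zero j)).pullbackAvoiding i.left (hav j))
          (primeCycle (genericPoint ↥X.left)) - -(3 • Pl₁ + 3 • Pl₂) =
        3 • (R (primeCycle (ι (pointOfVec T.left.functionField x hx0).pt)) -
          R (primeCycle (ι (pointOfVec T.left.functionField p hp0).pt)) + Pl₁) -
        (R ((pullbackFormDivisor (B := T) hF hF0).primeInter (X := (projectiveSpace (d + 1) k) ⊗ T) (ι lam)) -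
          (R (primeCycle (ι (pointOfVec T.left.functionField p hp0).pt)) + R V' +
            (R (primeCycle (ι (pointOfVec T.left.functionField p hp0).pt)) + R V') +
            (R (primeCycle (ι (pointOfVec T.left.functionField p hp0).pt)) + R V'))) -
        3 • (R V' - Pl₂) +
        (R ((pullbackFormDivisor (B := T) hF hF0).primeInter (X := (projectiveSpace (d + 1) k) ⊗ T) (ι lam)) -
          a • CartierDivisor.iterInter c
            (fun j => (formDivisor (ℓ j) (hℓ j) (hlin.ne_zero j)).pullbackAvoiding i.left (hav j))
            (primeCycle (genericPoint ↥X.left))) := by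
      abel
    rw [key]
    refine AddSubgroup.add_mem _ (AddSubgroup.sub_mem _ (AddSubgroup.sub_mem _
      (AddSubgroup.nsmul_mem _ hE1 3) hLX) (AddSubgroup.nsmul_mem _ hRV' 3)) ha


/-- **Mboro's tangent-line relation over a surface base, on the cubic hypersurface** (the lines of
the proof of Thm. 1.3 — tangent at `x` with one residual point — treated as in the proof of Thm. 1.2,
Case 2: "`(f_* ℙ_Σ̃)|_X = dΣ + R`" with "`d H_X · f_*(1) = i_X^* i_{X,*} f_*(1) ∈ ℤ · H_X^{d-2}`").
Let `X = V₊(F) ⊆ ℙᵈ⁺¹_k` be an integral cubic hypersurface over an algebraically closed field,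
`d ≥ 14`, `M = V₊(ℓ₁, …, ℓ_c) ⊄ X` a `3`-plane (`2 + c = d`) whose hyperplanes do not contain `X`,
`T` an integral proper surface base with a morphism `f : T → ℙ^𝐍` whose generic point is the
Plücker point of the `k(T)`-line `[x][y]`, tangent to `V₊(F)` at `[x]` with residual point `[y]`
(`F(s x + t y) = c s t²`, `c ≠ 0`). Then there are `a ∈ ℤ` and a cycle `Pl` on `X` supported on
plane points with
`2 · (pr₁₊[closure ι([x])])|_X + (pr₁₊[closure ι([y])])|_X - a · [X ∩ M] - Pl ∈ Rat₂(X)`.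
[cite: Mboro2018, proofs of Thm. 1.2 (Case 2, p. 7) and Thm. 1.3 (p. 8) (arXiv:1701.04488)] [cite: Fulton1998, Prop. 2.3 (c), Cor. 2.4.1] [cite: TianZong2014, Prop. 7.2 (proof)] -/
theorem exists_relation_of_tangent_line_over_T_lineSwept (hF : F ∈ grading (Fin (d + 1 + 1)) k 3) (hprime : Prime F)
    (hrange : Set.range i.left.base =
      ProjectiveSpectrum.zeroLocus (homogeneousSubmodule (Fin (d + 1 + 1)) k) {F})
    (hT2 : height (genericPoint T.left) = 2)
    {c : ℕ} (hdim : 2 + c = d) (ℓ : Fin c → MvPolynomial (Fin (d + 1 + 1)) k)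
    (hℓ : ∀ j, ℓ j ∈ grading (Fin (d + 1 + 1)) k 1) (hlin : LinearIndependent k ℓ)
    (hav : ∀ j, (formDivisor (ℓ j) (hℓ j) (hlin.ne_zero j)).Avoids (i.left.base (genericPoint ↥X.left)))
    (w : ↥(projectiveSpace (d + 1) k).left)
    (hw : (ProjectiveSpectrum.asHomogeneousIdeal
      (𝒜 := homogeneousSubmodule (Fin (d + 1 + 1)) k) w).toIdeal = Ideal.span (Set.range ℓ))
    (hFw : F ∉ ProjectiveSpectrum.asHomogeneousIdeal (𝒜 := homogeneousSubmodule (Fin (d + 1 + 1)) k) w)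
    (f : T ⟶ projectiveSpace ((d + 1) * (d + 1) + 2 * (d + 1)) k)
    (x y : Fin (d + 1 + 1) → T.left.functionField)
    (hxy : LinearIndependent T.left.functionField ![x, y])
    {c₀ : T.left.functionField} (hc₀ : c₀ ≠ 0)
    (htan : ∀ s t : T.left.functionField,
      eval (s • x + t • y) (MvPolynomial.map (algebraMap k T.left.functionField) F) = c₀ * s * t ^ 2)
    (P : Fin ((d + 1) * (d + 1) + 2 * (d + 1) + 1) → T.left.functionField)
    (hPw : ∀ a b, P (plIdx (d + 1) (a, b)) = wedge x y a b) (hP0 : P ≠ 0)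
    (hP : qgen T ≫ f.left = (pointOfVec k P hP0).left) :
    ∃ (a : ℤ) (Pl : AlgebraicCycle X.left ℤ), (∀ y', Pl y' ≠ 0 → IsLineSweptPoint i y') ∧
      2 • restrictMapFst T X i (primeCycle (genericFibreι (d + 1) T
          (pointOfVec T.left.functionField x (by simpa using hxy.ne_zero 0)).pt)) +
        restrictMapFst T X i (primeCycle (genericFibreι (d + 1) T
          (pointOfVec T.left.functionField y (by simpa using hxy.ne_zero 1)).pt)) -
        a • CartierDivisor.iterInter c
          (fun j => (formDivisor (ℓ j) (hℓ j) (hlin.ne_zero j)).pullbackAvoiding i.left (hav j))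
          (primeCycle (genericPoint ↥X.left)) - Pl ∈ ratTrivial X.left 2 := by
  classical
  haveI := infinite_functionField (k := k) T
  have hN : 1 ≤ d + 1 := by omega
  have hF0 : F ≠ 0 := hprime.ne_zero
  have hF3 : F.IsHomogeneous 3 := (mem_homogeneousSubmodule 3 F).1 hF
  -- the line forms
  obtain ⟨μ, hμli, hμhom, hμv, hμideal⟩ := exists_lineForms ![x, y] hxy hN
  have hμx : ∀ l, eval x (μ l) = 0 := fun l => hμv l 0
  have hμy : ∀ l, eval y (μ l) = 0 := fun l => hμv l 1
  have hμideal' : ∀ G : MvPolynomial (Fin (d + 1 + 1)) T.left.functionField,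
      (∀ s t : T.left.functionField, eval (s • x + t • y) G = 0) → G ∈ Ideal.span (Set.range μ) :=
    fun G hG => hμideal G fun s t => hG s t
  let R := restrictMapFst T X i
  -- (1) `pr₁^*V₊(F) · [closure ι(l)] = 2 [closure ι([x])] + [closure ι([y])] + V`
  obtain ⟨V, hZ, -, hVsupp⟩ := exists_primeInter_pullbackFormDivisor_line_eq_of_tangent (B := T) hN hT2 hxy
    hF hF0 hc₀ htan hμli hμhom hμx hμy hμideal'
  -- (2) the vertical part pushes forward to planes
  obtain ⟨Pl, hPl, hRV⟩ : ∃ Pl : AlgebraicCycle X.left ℤ, (∀ y', Pl y' ≠ 0 → IsLineSweptPoint i y') ∧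
      restrictMapFst T X i V - Pl ∈ ratTrivial X.left 2 :=
    ⟨restrictMapFst T X i V, restrictMapFst_vertical_lineSwept T X i hrange hT2 f x y P hPw hP0 hP hμli hμhom
      hμideal' V hVsupp, by rw [sub_self]; exact AddSubgroup.zero_mem _⟩
  -- (3) `(pr₁₊(pr₁^*V₊(F) · [closure ι(l)]))|_X ≡ a · [X ∩ M]`
  have hlam1 : height (linearSubspacePoint μ hμli hμhom (Nat.sub_le (d + 1) 1)) = 1 :=
    height_linearSubspacePoint_of_line hN μ hμli hμhom
  have hιlam : height (genericFibreι (d + 1) T (linearSubspacePoint μ hμli hμhom (Nat.sub_le (d + 1) 1))) =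
      (2 : ℕ) + 1 := by
    rw [height_genericFibreι_apply (d + 1) T hT2, hlam1]
  obtain ⟨a, ha⟩ := exists_restrictMapFst_primeInter_sub_mem T X i hF hprime hrange hdim ℓ hℓ hlin hav
    w hw hFw hιlam
  -- (4) assemble (with the plane cycle `-Pl`)
  refine ⟨a, -Pl, fun y' hy' => hPl y' (by
    rwa [Function.locallyFinsuppWithin.coe_neg, Pi.neg_apply, neg_ne_zero] at hy'), ?_⟩
  have hRZ : R ((pullbackFormDivisor (B := T) hF hF0).primeInter (X := (projectiveSpace (d + 1) k) ⊗ T)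
      (genericFibreι (d + 1) T (linearSubspacePoint μ hμli hμhom (Nat.sub_le (d + 1) 1)))) =
      2 • R (primeCycle (genericFibreι (d + 1) T
        (pointOfVec T.left.functionField x (by simpa using hxy.ne_zero 0)).pt)) +
      R (primeCycle (genericFibreι (d + 1) T
        (pointOfVec T.left.functionField y (by simpa using hxy.ne_zero 1)).pt)) + R V := by
    rw [hZ, map_add, map_add, map_nsmul]
  have key : 2 • R (primeCycle (genericFibreι (d + 1) T
        (pointOfVec T.left.functionField x (by simpa using hxy.ne_zero 0)).pt)) +
      R (primeCycle (genericFibreι (d + 1) T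
        (pointOfVec T.left.functionField y (by simpa using hxy.ne_zero 1)).pt)) -
      a • CartierDivisor.iterInter c
        (fun j => (formDivisor (ℓ j) (hℓ j) (hlin.ne_zero j)).pullbackAvoiding i.left (hav j))
        (primeCycle (genericPoint ↥X.left)) - -Pl =
      (R ((pullbackFormDivisor (B := T) hF hF0).primeInter (X := (projectiveSpace (d + 1) k) ⊗ T)
          (genericFibreι (d + 1) T (linearSubspacePoint μ hμli hμhom (Nat.sub_le (d + 1) 1)))) -
        a • CartierDivisor.iterInter c
          (fun j => (formDivisor (ℓ j) (hℓ j) (hlin.ne_zero j)).pullbackAvoiding i.left (hav j))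
          (primeCycle (genericPoint ↥X.left))) - (R V - Pl) := by
    rw [hRZ]; abel
  rw [key]
  exact AddSubgroup.sub_mem _ ha hRV

omit [IsIntegral X.left] in
/-- **The two sections of a family of lines on `X` over a surface base differ by planes.** Same
setting, but with the `k(T)`-line `[x][y]` contained in `X_{k(T)}` (`F ≡ 0` on `span(x, y)`): there
is a cycle `Pl` on `X` supported on plane points with
`(pr₁₊[closure ι([x])])|_X - (pr₁₊[closure ι([y])])|_X - Pl ∈ Rat₂(X)` — the relation
`[x] - [y] = div` on the line spread out over `T` (`exists_relation_of_line_over_T`, Tian–Zong's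
family technique; Mboro, proof of Thm. 1.2, Case 1: "`Σ = H_X · f_*(1) + P_*(p_* σ̃_*(D))`").
[cite: Mboro2018, proof of Thm. 1.2, Case 1 (arXiv:1701.04488, p. 7)] [cite: TianZong2014, Prop. 7.2 (proof)] -/
theorem exists_relation_of_line_in_X_over_T'_lineSwept
    (hrange : Set.range i.left.base =
      ProjectiveSpectrum.zeroLocus (homogeneousSubmodule (Fin (d + 1 + 1)) k) {F})
    (hT2 : height (genericPoint T.left) = 2)
    (f : T ⟶ projectiveSpace ((d + 1) * (d + 1) + 2 * (d + 1)) k)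
    (x y : Fin (d + 1 + 1) → T.left.functionField)
    (hxy : LinearIndependent T.left.functionField ![x, y])
    (hFline : ∀ s t : T.left.functionField,
      eval (s • x + t • y) (MvPolynomial.map (algebraMap k T.left.functionField) F) = 0)
    (P : Fin ((d + 1) * (d + 1) + 2 * (d + 1) + 1) → T.left.functionField)
    (hPw : ∀ a b, P (plIdx (d + 1) (a, b)) = wedge x y a b) (hP0 : P ≠ 0)
    (hP : qgen T ≫ f.left = (pointOfVec k P hP0).left) :
    ∃ Pl : AlgebraicCycle X.left ℤ, (∀ y', Pl y' ≠ 0 → IsLineSweptPoint i y') ∧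
      restrictMapFst T X i (primeCycle (genericFibreι (d + 1) T
          (pointOfVec T.left.functionField x (by simpa using hxy.ne_zero 0)).pt)) -
        restrictMapFst T X i (primeCycle (genericFibreι (d + 1) T
          (pointOfVec T.left.functionField y (by simpa using hxy.ne_zero 1)).pt)) - Pl ∈
        ratTrivial X.left 2 := by
  classical
  haveI := infinite_functionField (k := k) T
  haveI : IsProper (projectiveSpace (d + 1) k).hom := isProper_projectiveSpace (d + 1) k
  haveI : IsProper X.hom := by rw [← Over.w i]; infer_instance
  haveI : LocallyOfFiniteType (X ⊗ T).hom :=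
    inferInstanceAs (LocallyOfFiniteType (pullback.fst X.hom T.hom ≫ X.hom))
  let ι := genericFibreι (d + 1) T
  let R := restrictMapFst T X i
  let M : AlgebraicCycle (X ⊗ T).left ℤ → AlgebraicCycle X.left ℤ :=
    AlgebraicCycle.map (CartesianMonoidalCategory.fst X T).left height height
  obtain ⟨c', hc', uX, huX, Pl₁, hPl₁, hE⟩ := exists_relation_of_line_over_T_lineSwept T X i hrange hT2 f
    ![x, y] hxy hFline P hPw hP0 hP
  have hMc' : M c' ∈ ratTrivial X.left 2 :=
    map_mem_ratTrivial_holds (d := 2) (CartesianMonoidalCategory.fst X T) hc'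
  have hjι : ∀ q, (i ▷ T).left.base ((ιX T X).base q) = ι ((iK (d + 1) T X i).base q) := by
    intro q
    change ((ιX T X ≫ (i ▷ T).left).base q) = ((iK (d + 1) T X i ≫ genericFibreι (d + 1) T).base q)
    rw [iK_genericFibreι]
  have hMu : ∀ a, M (primeCycle ((ιX T X).base (uX a))) =
      R (primeCycle (ι (pointOfVec T.left.functionField (![x, y] a) (hxy.ne_zero a)).pt)) := by
    intro a
    rw [← huX a, ← hjι]
    exact (restrictMapFst_primeCycle_whiskerRight T X i _).symm
  refine ⟨-Pl₁, fun y' hy' => hPl₁ y' (by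
    rwa [Function.locallyFinsuppWithin.coe_neg, Pi.neg_apply, neg_ne_zero] at hy'), ?_⟩
  have h0 : M (primeCycle ((ιX T X).base (uX 0))) =
      R (primeCycle (ι (pointOfVec T.left.functionField x (by simpa using hxy.ne_zero 0)).pt)) := hMu 0
  have h1 : M (primeCycle ((ιX T X).base (uX 1))) =
      R (primeCycle (ι (pointOfVec T.left.functionField y (by simpa using hxy.ne_zero 1)).pt)) := hMu 1
  have key : R (primeCycle (ι (pointOfVec T.left.functionField x (by simpa using hxy.ne_zero 0)).pt)) -
      R (primeCycle (ι (pointOfVec T.left.functionField y (by simpa using hxy.ne_zero 1)).pt)) - -Pl₁ =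
      M c' - (M c' - (M (primeCycle ((ιX T X).base (uX 0))) - M (primeCycle ((ιX T X).base (uX 1)))) - Pl₁) := by
    rw [h0, h1]; abel
  rw [key]
  exact AddSubgroup.sub_mem _ hMc' hE

end Relation

end ProjFamily

end Literature.AlgebraicGeometry.Motives
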